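import Summits.BirchSwinnertonDyer.BirchSwinnertonDyer.Theorems.AdditiveBranchIMCGordTwoRankOneHeegnerKolyvagin
import Literature.NumberTheory.EllipticCurves.KolyvaginShaIndexBound
import HarnessLib

/-!
# Route `AdditiveBranchIMC` (rung K1), crux `GordTwoRankOne` (item 19358): the Heegner–Kolyvagin road,
# Part 6 — the UPPER half and full `BSD(E,p)` on this road: Kolyvagin's bound + the RANK-ZERO lower half
# of the twist at the SAME additive prime (cell `bsd-addord`, second prover lane `bsd-addord-k1-c3x`, gen 0)

HONEST FRAMING. THEOREMS ONLY: no definition, no new named fact, no `sorry`; nothing is booked; BSD is not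
proved by any of this; the crux (the LOWER half) and its rank-zero sibling stay OPEN at class level. This
file is bookkeeping FOR THE PLANNER: on the Heegner–Kolyvagin road the OTHER half of `BSD(E,p)` for a
rank-one curve at an additive potentially good prime `p` (Jetchev–Skinner–Wan 2017 §7.4.2 run at `p² ∣ N`)
needs NO `p`-adic Gross–Zagier identity and NO `p`-adic height (lane A's rank-one upper half goes through
Kato's half + the Disegni identity): it follows from Kolyvagin's PUBLISHED bound
`ord_p #Ш(E/K) ≤ 2·ord_p [E(K):ℤP]` (Kolyvagin 1990 Thm. A / McCallum 1991 §1, tree fact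
`Kolyvagin1990_padicValNat_card_sha_le`, reduction-agnostic) + the `≥`-half of the rank-ZERO `p`-part for
the twist `E^{d_K}` — which, `p` being split in the Heegner field, is additive potentially good at the SAME
prime: i.e. THE LOWER HALF OF CRUX `GordTwoRankZeroOffCaseOne` (item 19357) AT THE TWIST, in the class-free
currency `Typed.MissingLowerBoundAt Wd p` — + `p ∤ ∏c_ℓ(E)` + a Manin-unit datum (Edixhoven at `p ≥ 11`,
Part 2). So on this road: `BSD(E,p)` for the rank-one (G-ord, `e = 2`) tower-surjective rows with
`p ∤ ∏c_ℓ(E)` ⟸ STEP L_add (rank-one input) + the rank-zero lower half at the twist (19357's object) +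
PUBLISHED facts. Theorems: `twist_ge_half_of_missingLowerBoundAt` (currency conversion),
`missingUpperBoundAt_rankOne_additive_of_twistLower` (pointwise upper half), and
`bsdp_rankOne_additive_of_indexLowerBoundAt_of_twistLower` (both halves ⇒ `BSDp W p`).

References: [JetchevSkinnerWan2017] §7.4.2; [KolyvaginEulerSystems1990] Thm. A; [McCallumLMS1991] §1;
[GrossZagier1986] V.§2; [Miller2011LMS] Def 1.1.
-/

set_option autoImplicit false
set_option linter.dupNamespace false
noncomputable section

open scoped Classical NumberField
open WeierstrassCurve NumberField IsDedekindDomain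
  Literature.NumberTheory.EllipticCurves Literature.NumberTheory.EllipticCurves.ModularForms
  Literature.NumberTheory.EllipticCurves.Rank1Residual
  Literature.NumberTheory.EllipticCurves.Rank1Residual.Typed
  Summit.BirchSwinnertonDyer.Rank1Residual
  Summit.BirchSwinnertonDyer.Rank1Residual.Additive
  Summit.BirchSwinnertonDyer.Rank1Residual.X11b
  Summit.BirchSwinnertonDyer.Rank1Residual.GaloisImage
  Literature.NumberTheory.Automorphic

namespace Summit.BirchSwinnertonDyer.BirchSwinnertonDyer.Theorems.AdditiveBranchIMCGordTwoRankOne.HeegnerKolyvagin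

/-! ### §10 The twist's `≥`-half from the rank-zero lower half in the cell's currency -/

/-- **Currency conversion for the rank-zero twist.** For `Wd/ℚ` globally minimal with `L(Wd,1) ≠ 0`
(modularity `hmod`; GZK `hGZK` for `rank = 0`): the cell's typed LOWER half
`Typed.MissingLowerBoundAt Wd p` (`#Ш(Wd)_an = q'`, `ord_p q' ≤ ord_p #Ш(Wd)`) gives the `≥`-half in
Jetchev–Skinner–Wan's shape, `∃ q, L(Wd,1)/Ω = q ∧ ord_p q ≤ ord_p #Ш(Wd) + ord_p ∏c_ℓ(Wd) − 2·ord_p #Wd(ℚ)_tors`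
(`#Ш_an = L(E,1)·#tors²/(Ω·∏c_ℓ)` in rank `0`: `shaAn_def`, `leadingLCoeff_eq_of_analyticRank_eq_zero`,
`regulator_eq_one_of_rank_zero`) — the binder `htw` of x11b's `missingUpperBoundAt_of_shaIndexBound`.
[cite: Miller2011LMS, §1 and Def. 1.1] [cite: JetchevSkinnerWan2017, §7.4.2 (p. 31)] -/
theorem twist_ge_half_of_missingLowerBoundAt
    (hGZK : rank_eq_analyticRank_of_analyticRank_le_one) (hmod : hasEntireLFunction_rat)
    (Wd : WeierstrassCurve ℚ) [Wd.IsElliptic] [Wd.IsGloballyMinimal] (p : ℕ) [Fact p.Prime]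
    (hL : Wd.entireLFunction 1 ≠ 0) (hlow : Typed.MissingLowerBoundAt Wd p) :
    ∃ q : ℚ, Wd.entireLFunction 1 / (Wd.realPeriodRat : ℂ) = (q : ℂ) ∧
      padicValRat p q ≤ (padicValNat p Wd.shaOrder : ℤ) + padicValNat p Wd.tamagawaProduct -
        2 * padicValNat p Wd.torsionOrder := by
  obtain ⟨q', hq', hv'⟩ := hlow
  have hrd : Wd.analyticRank = 0 := (Wd.analyticRank_eq_zero_iff_holds (hmod Wd)).2 hL
  obtain ⟨hmw, -⟩ := hGZK Wd (by rw [hrd]; exact zero_le_one)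
  have hmw0 : Wd.mordellWeilRank = 0 := by rw [hmw, hrd]
  have hΩpos : 0 < Wd.realPeriodRat := Wd.realPeriodRat_pos_holds
  have hΩ : (Wd.realPeriodRat : ℂ) ≠ 0 := by exact_mod_cast hΩpos.ne'
  have hc0 : 0 < Wd.tamagawaProduct := Wd.tamagawaProduct_pos_holds
  have ht0 : 0 < Wd.torsionOrder := Wd.torsionOrder_pos_holds
  have hcq : (Wd.tamagawaProduct : ℚ) ≠ 0 := by exact_mod_cast hc0.ne'
  have htq : (Wd.torsionOrder : ℚ) ≠ 0 := by exact_mod_cast ht0.ne'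
  -- `#Ш_an(Wd) = L(Wd,1)·t²/(Ω·c)`, so `L(Wd,1)/Ω = q'·c/t²`
  have hsha : shaAn Wd = Wd.entireLFunction 1 * (Wd.torsionOrder : ℂ) ^ 2 /
      ((Wd.realPeriodRat : ℂ) * (Wd.tamagawaProduct : ℂ)) := by
    rw [shaAn_def, leadingLCoeff_eq_of_analyticRank_eq_zero Wd hrd, Wd.regulator_eq_one_of_rank_zero hmw0]
    push_cast
    rw [mul_one]
  have hq'0 : q' ≠ 0 := by
    intro h0
    rw [h0, Rat.cast_zero] at hq'
    rw [hq'] at hsha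
    have htC : (Wd.torsionOrder : ℂ) ≠ 0 := by exact_mod_cast ht0.ne'
    have hcC : (Wd.tamagawaProduct : ℂ) ≠ 0 := by exact_mod_cast hc0.ne'
    have : Wd.entireLFunction 1 * (Wd.torsionOrder : ℂ) ^ 2 = 0 := by
      have h := hsha.symm
      rw [div_eq_zero_iff] at h
      rcases h with h | h
      · exact h
      · exact absurd h (mul_ne_zero hΩ hcC)
    rcases mul_eq_zero.mp this with h | h
    · exact hL h
    · exact htC (pow_eq_zero_iff two_ne_zero |>.mp h)
  refine ⟨q' * (Wd.tamagawaProduct : ℚ) / (Wd.torsionOrder : ℚ) ^ 2, ?_, ?_⟩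
  · have htC : (Wd.torsionOrder : ℂ) ≠ 0 := by exact_mod_cast ht0.ne'
    have hcC : (Wd.tamagawaProduct : ℂ) ≠ 0 := by exact_mod_cast hc0.ne'
    have key : (q' : ℂ) = Wd.entireLFunction 1 * (Wd.torsionOrder : ℂ) ^ 2 /
        ((Wd.realPeriodRat : ℂ) * (Wd.tamagawaProduct : ℂ)) := by rw [← hq', hsha]
    push_cast
    rw [key]
    field_simp
  · rw [padicValRat.div (mul_ne_zero hq'0 hcq) (pow_ne_zero 2 htq), padicValRat.mul hq'0 hcq, pow_two,
      padicValRat.mul htq htq, padicValRat.of_nat, padicValRat.of_nat]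
    have hv'' : padicValRat p q' ≤ (padicValNat p Wd.shaOrder : ℤ) := by exact_mod_cast hv'
    linarith

/-! ### §11 The pointwise UPPER half and `BSD(E,p)` on the road -/

/-- **THE POINTWISE UPPER HALF at an additive prime from Kolyvagin's bound + the rank-ZERO lower half of
the twist** (Jetchev–Skinner–Wan 2017 §7.4.2 run at `p² ∣ N`, via x11b's class-free
`missingUpperBoundAt_of_shaIndexBound`). Data: `W/ℚ` globally minimal of conductor `N`, `ord_{s=1} L(E,s) = 1`,
`p ≥ 5` with `ρ̄_{E,p}` onto and `p ∤ ∏c_ℓ(E)`; Heegner data (`K`, `Dt` with `p ∤ c(Dt)`, `H`, `ι`, `P`,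
`p ∤ #𝓞_K^×`, `L(E^{d_K},1) ≠ 0`); `Wd` a globally minimal model of the twist (ANY reduction type at `p` —
on the cell it is additive potentially good at `p`, Part 1 `addv_twist_of_heegner`). PUBLISHED binders:
`hGZ`, `hKo`, `hB` (Kolyvagin 1990 Thm. A: `ord_p #Ш(E/K) ≤ 2·ord_p[E(K):ℤP]`, reduction-agnostic),
`hGZK`, `hmod`. TYPED INPUT: `htwL : Typed.MissingLowerBoundAt Wd p` — the LOWER half of the `p`-part for
the rank-ZERO twist, i.e. crux `GordTwoRankZeroOffCaseOne` (item 19357)'s conclusion at the pair `(Wd, p)`.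
CONCLUSION: `Typed.MissingUpperBoundAt W p` (`ord_p #Ш(E) ≤ ord_p #Ш(E)_an`). No `p`-adic height, no
`p`-adic Gross–Zagier identity. [cite: JetchevSkinnerWan2017, §7.4.2 (eq:shaupper), p. 31]
[cite: McCallumLMS1991, §1 Theorem (Kolyvagin), p. 296] [cite: Miller2011LMS, Def. 1.1] -/
theorem missingUpperBoundAt_rankOne_additive_of_twistLower
    (W : WeierstrassCurve ℚ) [W.IsElliptic] [W.IsGloballyMinimal] (p : ℕ) [Fact p.Prime]
    [NeZero (W.conductorNorm ℤ)] (K : Type) [Field K] [NumberField K]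
    (Dt : ModularParametrizationData W (W.conductorNorm ℤ))
    (H : HeegnerDatum (W.conductorNorm ℤ) (NumberField.discr K)) (ι : K →+* ℂ)
    (P : (W.baseChange K).toAffine.Point)
    -- the published inputs (named facts of the tree)
    (hGZ : gross_zagier (W.conductorNorm ℤ) W K) (hKo : kolyvagin (W.conductorNorm ℤ) W K)
    (hB : Kolyvagin1990_padicValNat_card_sha_le (W.conductorNorm ℤ) W K)
    (hGZK : rank_eq_analyticRank_of_analyticRank_le_one) (hmod : hasEntireLFunction_rat)
    -- the pair
    (hr : W.analyticRank = 1) (hp5 : 5 ≤ p) (hsurj : Surj W p) (htam0 : ¬ p ∣ W.tamagawaProduct)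
    -- the Heegner data
    (hK : IsImaginaryQuadratic K) (hHN : SatisfiesHeegnerHypothesis (W.conductorNorm ℤ) K)
    (hP : WeierstrassCurve.Affine.Point.map ι.toRatAlgHom P = heegnerPointComplex Dt H)
    (hc : ¬ (p : ℤ) ∣ Dt.c) (hμ : ¬ p ∣ Units.torsionOrder K)
    (hLt : (W.quadraticTwist (NumberField.discr K : ℚ)).entireLFunction 1 ≠ 0)
    (Wd : WeierstrassCurve ℚ) [Wd.IsElliptic] [Wd.IsGloballyMinimal] (Cd : VariableChange ℚ)
    (hWd : Cd • W.quadraticTwist (NumberField.discr K : ℚ) = Wd)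
    (hng : ¬ W.HasGoodReductionAtPrime p)
    -- the rank-zero lower half at the twist (crux 19357's object at `(Wd, p)`)
    (htwL : Typed.MissingLowerBoundAt Wd p) :
    Typed.MissingUpperBoundAt W p := by
  have hp : p.Prime := Fact.out
  have hp2 : p ≠ 2 := by omega
  have hD0 : (NumberField.discr K : ℚ) ≠ 0 := by exact_mod_cast NumberField.discr_ne_zero K
  haveI hEt : (W.quadraticTwist (NumberField.discr K : ℚ)).IsElliptic := W.isElliptic_quadraticTwist hD0
  have htam : padicValNat p Wd.tamagawaProduct = padicValNat p W.tamagawaProduct :=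
    padicValNat_tamagawaProduct_twist_of_heegner W p hp5 K hK hHN Cd hWd
  have hu : padicValRat p (Cd.u : ℚ) = 0 :=
    padicValRat_u_eq_zero_of_twist_minimal' W p K hK hHN hng Cd hWd
  have hLt' : (W.quadraticTwist (NumberField.discr K : ℚ)).entireLFunction = Wd.entireLFunction := by
    rw [← hWd, entireLFunction_smul]
  have hLd1 : Wd.entireLFunction 1 ≠ 0 := by rw [← hLt']; exact hLt
  have htw := twist_ge_half_of_missingLowerBoundAt hGZK hmod Wd p hLd1 htwL
  have hU : Finite (W.baseChange K).sha → ¬ IsOfFinAddOrder P →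
      padicValNat p (Nat.card (W.baseChange K).sha) ≤
        2 * padicValNat p (AddSubgroup.zmultiples P).index :=
    fun _ hnt ↦ hB hK hHN ⟨Dt, H, ι, hP⟩ hnt hp hp2 hsurj
  exact missingUpperBoundAt_of_shaIndexBound W p (W.conductorNorm ℤ) K Dt H ι P hGZ hKo hGZK hmod hK hHN hP
    hp2 hc hμ hr hLt Wd Cd hWd hu htam htam0 htw hU

/-- **`BSD(E,p)` ON THE ROAD: both halves.** For a rank-one globally minimal `E/ℚ` and a prime `p ≥ 5` of
additive potentially good reduction with `ρ̄_{E,p^n}` onto for all `n` and `p ∤ ∏c_ℓ(E)`, at fixed Heegner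
data with `p ∤ c(Dt)`: STEP L_add at `P` (rank-one input, `hL`) + the rank-ZERO lower half at the twist
(`htwL : Typed.MissingLowerBoundAt Wd p`, crux 19357's object at `(Wd, p)`; `Wd` is additive potentially good
at `p` by Part 1) + PUBLISHED facts (`hGZ`, `hKo`, `hB`, `hKatoT`, `hGZK`, `hmod`) ⊢ `BSDp W p` — LOWER by
Part 1's `missingLowerBoundAt_rankOne_additive_of_indexLowerBoundAt`, UPPER by
`missingUpperBoundAt_rankOne_additive_of_twistLower`, glued by x11b's `bsdp_of_halves`. No Λ-adic branch
object, no `p`-adic height / Gross–Zagier identity, no Schneider, no `A′`. Per pair; nothing booked.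
[cite: JetchevSkinnerWan2017, §7.4.1–7.4.3 (pp. 29–31)] [cite: Miller2011LMS, §1 and Def. 1.1] -/
theorem bsdp_rankOne_additive_of_indexLowerBoundAt_of_twistLower
    (W : WeierstrassCurve ℚ) [W.IsElliptic] [W.IsGloballyMinimal] (p : ℕ) [Fact p.Prime]
    [NeZero (W.conductorNorm ℤ)] (K : Type) [Field K] [NumberField K]
    (Dt : ModularParametrizationData W (W.conductorNorm ℤ))
    (H : HeegnerDatum (W.conductorNorm ℤ) (NumberField.discr K)) (ι : K →+* ℂ)
    (P : (W.baseChange K).toAffine.Point)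
    -- the published inputs (named facts of the tree)
    (hGZ : gross_zagier (W.conductorNorm ℤ) W K) (hKo : kolyvagin (W.conductorNorm ℤ) W K)
    (hB : Kolyvagin1990_padicValNat_card_sha_le (W.conductorNorm ℤ) W K)
    (hKatoT : Kato2004.rankZero_padicValNat_sha_add_padicValNat_tamagawa_le_of_additive_potGood_of_imageContainsSL2)
    (hGZK : rank_eq_analyticRank_of_analyticRank_le_one) (hmod : hasEntireLFunction_rat)
    -- the pair
    (hr : W.analyticRank = 1) (hp5 : 5 ≤ p) (hadd : Addv W p) (hj : 0 ≤ padicValRat p W.j)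
    (hsurj : ∀ n : ℕ, W.HasSurjectiveModNGaloisRep (p ^ n : ℕ)) (htam0 : ¬ p ∣ W.tamagawaProduct)
    -- the Heegner data
    (hK : IsImaginaryQuadratic K) (hHN : SatisfiesHeegnerHypothesis (W.conductorNorm ℤ) K)
    (hP : WeierstrassCurve.Affine.Point.map ι.toRatAlgHom P = heegnerPointComplex Dt H)
    (hc : ¬ (p : ℤ) ∣ Dt.c) (hμ : ¬ p ∣ Units.torsionOrder K)
    (hLt : (W.quadraticTwist (NumberField.discr K : ℚ)).entireLFunction 1 ≠ 0)
    (Wd : WeierstrassCurve ℚ) [Wd.IsElliptic] [Wd.IsGloballyMinimal] (Cd : VariableChange ℚ)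
    (hWd : Cd • W.quadraticTwist (NumberField.discr K : ℚ) = Wd)
    -- the two typed inputs: STEP L_add (rank one) and the rank-zero lower half at the twist
    (hL : Finite (W.baseChange K).sha → IndexLowerBoundAt W p K P)
    (htwL : Typed.MissingLowerBoundAt Wd p) : BSDp W p := by
  have hp : p.Prime := Fact.out
  have hp2 : p ≠ 2 := by omega
  have hsurj1 : Surj W p := by simpa using hsurj 1
  exact bsdp_of_halves hGZK W p (le_of_eq hr)
    (missingLowerBoundAt_rankOne_additive_of_indexLowerBoundAt W p K Dt H ι P hGZ hKo hKatoT hGZK hmod hr hp2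
      hadd hj hsurj hK hHN hP hc hμ hLt Wd Cd hWd hL)
    (missingUpperBoundAt_rankOne_additive_of_twistLower W p K Dt H ι P hGZ hKo hB hGZK hmod hr hp5 hsurj1
      htam0 hK hHN hP hc hμ hLt Wd Cd hWd hadd.1 htwL)

end Summit.BirchSwinnertonDyer.BirchSwinnertonDyer.Theorems.AdditiveBranchIMCGordTwoRankOne.HeegnerKolyvagin

end
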